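import Literature.Barriers.RiemannHypothesis.EpsteinZetaCentralValueExact
import Literature.Barriers.RiemannHypothesis.EpsteinZetaBatemanGrosswaldEq11Proofs
import HarnessLib

/-!
# A positive definite binary form whose Epstein zeta function vanishes at the central point `s = ½` (to even order)

Proof file (no definitions; everything is proved) in the series attached to the barrier
`Literature/Barriers/RiemannHypothesis/EpsteinZetaRealZeros.lean`
(`Literature.Barriers.RiemannHypothesis.EpsteinZetaRealZeros`), written for the barrier audit of
generation 7 (D-0021) of the discharge file `EpsteinZetaRealZerosProofs.lean`. It records a
delimitation of the catalogued technique class that the printed sources leave implicit: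

**the family of Epstein zeta functions of positive definite real binary forms contains a member
vanishing AT the central point.** Precisely (`exists_form_central_zero`): there is
`c⋆ ∈ (7.0554², 7.0556²)` such that every analytic continuation `Z` of the Epstein zeta function of
`Q⋆ = x² + c⋆y²` (Stark's parameter `k = √c⋆ ∈ (7.0554, 7.0556)`, the Bateman–Grosswald window
between (11) `Z(½) < 0` for `k ≤ 7.0554` and (10) `Z(½) > 0` for `k ≥ 7.0556`) satisfies
`Z(½) = 0`; and a central zero of ANY Epstein zeta function of the family is at least a double
zero (`deriv_half_eq_zero_of_half_eq_zero`: `ξ_Q(s) = ξ_Q(1 − s)` makes `ξ_Q` even about `½`).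

Consequently no argument using only the properties shared by every `ζ_Q` (functional equation,
theta series, the expansion `ζ(2s) + k^{1−2s}ζ(2s−1)Γ(s−½)√π/Γ(s) + h(s)`, class-by-class
treatment) can prove NON-VANISHING AT THE CENTRAL POINT — Chowla's problem `L(½, χ) ≠ 0` for
`ζ_K(½) = ζ(½)L(½, χ_d)`, `K` imaginary quadratic — nor the SIMPLICITY of the zeros on the
critical line (Stark's Theorem 1 gives simplicity only for `k > K`), nor any repulsion between
consecutive critical zeros: at `k = √c⋆` two critical zeros `½ ± iγ` have collided at `s = ½`
(numerically this is the "left edge zero" `Δ*_c = 0.141733…`, `1/Δ*_c = 7.05551…` of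
Bétermin–Šamaj–Travěnec, §4.2, from which the real pair `ρ, 1 − ρ` of Bateman–Grosswald and
Stark emerges and then sweeps out `(½, 1)` as `k → ∞`). This complements what the barrier block
already records ("all zeros on `σ = ½`" / "no real zero in `(½, 1)`" is blocked): central
vanishing and multiple zeros ON the line are blocked as well.

## The proof

By `EpsteinZetaCentralValueExact.re_Λ_half_eq_exact`, along the rectangular family `z = iy`
(`cos(2πxmk) = 1`)

  `Λ_{iy}(½) = g(y) := 2√y(γ + log y − log 4π) + 4√y Σ_{m,k≥1} I(πymk)`,
  `I(κ) = ∫₀^∞ t⁻¹ e^{−κ(t+1/t)} dt` (`= 2K₀(2κ)`),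

and `g` is continuous on `[y₀, ∞)` for every `y₀ > 0`: `κ ↦ I(κ)` is continuous on `[κ₀, ∞)` by
dominated convergence (the integrand decreases in `κ`; `continuousOn_besselIntegral`), and the
double series converges uniformly on `[y₀, ∞)`, being dominated by its value at `y₀`
(`EpsteinZetaCentralValueExact.summable_cross_norms`; `continuousOn_tsum_besselIntegral`). Since
`Λ_{iy}(½) < 0` at `y = 7.0554` (`EpsteinZetaBatemanGrosswaldEq11Proofs.re_Λ_half_neg`) and `> 0` at
`y = 7.0556` (`EpsteinZetaCentralValueSharp.re_Λ_half_pos_of_le`), the intermediate value theorem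
gives `y⋆ ∈ (7.0554, 7.0556)` with `Λ_{iy⋆}(½) = 0`, and `Z(½) = c(½)Λ_{z}(½)` for every continuation
`Z` of `ζ_Q`, `Q = (y⋆², 0, 1) ~ (1, 0, y⋆²)` (`EpsteinZetaCentralValue.continuation_ofReal_eq`). The
double zero: the continuation `Z₀` of `MontgomeryVaughan2007_epsteinContinuation_holds` satisfies
`ξ(s) = ξ(1 − s)` at all non-integers, in particular on the ball `|s − ½| < ½`; so
`ξ′(½) = −ξ′(½) = 0`, and `ξ = Z₀·Γ(s)D^{s/2}(2π)^{−s}` with `Z₀(½) = 0` and a non-vanishing second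
factor forces `Z₀′(½) = 0`; any continuation agrees with `Z₀` near `½`.

## References

* [BatemanGrosswald1964] P. T. Bateman, E. Grosswald, *On Epstein's zeta function*, Acta Arith. 9
  (1964) 365–373, Theorem 3 (10)–(11) (the two thresholds `7.0554`, `7.0556`).
* [BeterminSamajTravenec2021] L. Bétermin, L. Šamaj, I. Travěnec, *Interplay between critical and
  off-critical zeros of two-dimensional Epstein zeta functions*, arXiv:2110.09368, abstract and
  §4.2 (the critical "edge zero" on the real axis at `Δ*_c = 0.141733239663887…`, from which the
  real off-critical pair splits; numerics) (read).
* [Stark1967EpsteinZeros] H. M. Stark, *On the zeros of Epstein's zeta function*, Mathematika 14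
  (1967) 47–55, Theorem 1 (simplicity of the zeros for `k > K` only).
-/

noncomputable section

open Complex Filter Topology MeasureTheory Set HurwitzZeta
open scoped UpperHalfPlane

namespace Literature.Barriers.RiemannHypothesis

open Literature.NumberTheory.Automorphic
open Literature.Analysis.SpecialFunctions.BesselK0

/-! ## Continuity of `I(κ) = ∫₀^∞ t⁻¹e^{−κ(t+1/t)}dt` in `κ` -/

/-- The integrand `t⁻¹e^{−κ(t+1/t)}` decreases in `κ` (`t > 0`). [folklore] -/
theorem inv_mul_exp_le_of_le {κ₀ κ t : ℝ} (hκ : κ₀ ≤ κ) (ht : 0 < t) :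
    t⁻¹ * Real.exp (-κ * (t + t⁻¹)) ≤ t⁻¹ * Real.exp (-κ₀ * (t + t⁻¹)) := by
  have h1 : 0 < t + t⁻¹ := by positivity
  refine mul_le_mul_of_nonneg_left (Real.exp_le_exp.2 ?_) (inv_pos.2 ht).le
  nlinarith

/-- `I(κ) ≤ I(κ₀)` for `κ ≥ κ₀ > 0`. [folklore] -/
theorem besselIntegral_anti {κ₀ κ : ℝ} (hκ₀ : 0 < κ₀) (hκ : κ₀ ≤ κ) :
    ∫ t in Ioi (0 : ℝ), t⁻¹ * Real.exp (-κ * (t + t⁻¹)) ≤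
      ∫ t in Ioi (0 : ℝ), t⁻¹ * Real.exp (-κ₀ * (t + t⁻¹)) :=
  setIntegral_mono_on (integrableOn_and_integral_inv_mul_exp_le (hκ₀.trans_le hκ)).1
    (integrableOn_and_integral_inv_mul_exp_le hκ₀).1 measurableSet_Ioi
    fun _ ht => inv_mul_exp_le_of_le hκ ht

/-- **`κ ↦ I(κ)` is continuous on `[κ₀, ∞)`** (`κ₀ > 0`): dominated convergence, the integrand at
`κ₀` dominating. [folklore] -/
theorem continuousOn_besselIntegral {κ₀ : ℝ} (hκ₀ : 0 < κ₀) :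
    ContinuousOn (fun κ : ℝ => ∫ t in Ioi (0 : ℝ), t⁻¹ * Real.exp (-κ * (t + t⁻¹))) (Ici κ₀) := by
  have hint := (integrableOn_and_integral_inv_mul_exp_le hκ₀).1
  refine continuousOn_of_dominated (bound := fun t : ℝ => t⁻¹ * Real.exp (-κ₀ * (t + t⁻¹)))
    (fun κ hκ => ?_) (fun κ hκ => ?_) hint ?_
  · exact (integrableOn_and_integral_inv_mul_exp_le (hκ₀.trans_le hκ)).1.integrable.aestronglyMeasurable
  · filter_upwards [ae_restrict_mem measurableSet_Ioi] with t ht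
    have ht0 : (0 : ℝ) < t := ht
    rw [Real.norm_of_nonneg (by positivity)]
    exact inv_mul_exp_le_of_le hκ ht0
  · filter_upwards with t
    have hc : Continuous fun κ : ℝ => t⁻¹ * Real.exp (-κ * (t + t⁻¹)) :=
      continuous_const.mul ((continuous_neg.mul continuous_const).rexp)
    exact hc.continuousOn

/-! ## Continuity of the cross-term series along the rectangular family `z = iy` -/

/-- **`y ↦ Σ_{m,k≥1} I(πymk)` is continuous on `[y₀, ∞)`** (`y₀ > 0`): each term is continuous and
the series is dominated by its (summable) value at `y₀`. [folklore] -/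
theorem continuousOn_tsum_besselIntegral {y₀ : ℝ} (hy₀ : 0 < y₀) :
    ContinuousOn (fun y : ℝ => ∑' p : ℕ × ℕ, ∫ t in Ioi (0 : ℝ),
      t⁻¹ * Real.exp (-(Real.pi * y * ((p.1 : ℝ) + 1) * ((p.2 : ℝ) + 1)) * (t + t⁻¹))) (Ici y₀) := by
  have hsy : Real.sqrt y₀ ≠ 0 := (Real.sqrt_pos.2 hy₀).ne'
  -- the dominating sequence: the terms at `y₀`
  have hsum : Summable fun p : ℕ × ℕ => 4 * Real.sqrt y₀ * ∫ t in Ioi (0 : ℝ),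
      t⁻¹ * Real.exp (-(Real.pi * y₀ * ((p.1 : ℝ) + 1) * ((p.2 : ℝ) + 1)) * (t + t⁻¹)) := by
    refine (summable_cross_norms hy₀ 0).congr fun p => ?_
    simp only [mul_zero, zero_mul, Real.cos_zero, abs_one, mul_one]
  have hu : Summable fun p : ℕ × ℕ => ∫ t in Ioi (0 : ℝ),
      t⁻¹ * Real.exp (-(Real.pi * y₀ * ((p.1 : ℝ) + 1) * ((p.2 : ℝ) + 1)) * (t + t⁻¹)) := by
    refine (hsum.mul_left (1 / (4 * Real.sqrt y₀))).congr fun p => ?_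
    field_simp
  refine continuousOn_tsum (fun p => ?_) hu fun p y hy => ?_
  · -- continuity of one term
    have hκ₀ : 0 < Real.pi * y₀ * ((p.1 : ℝ) + 1) * ((p.2 : ℝ) + 1) := by positivity
    have hlin : Continuous fun y : ℝ => Real.pi * y * ((p.1 : ℝ) + 1) * ((p.2 : ℝ) + 1) := by
      fun_prop
    have hmaps : MapsTo (fun y : ℝ => Real.pi * y * ((p.1 : ℝ) + 1) * ((p.2 : ℝ) + 1)) (Ici y₀)
        (Ici (Real.pi * y₀ * ((p.1 : ℝ) + 1) * ((p.2 : ℝ) + 1))) := fun y hy => by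
      have hy' : y₀ ≤ y := hy
      have h0 : 0 ≤ Real.pi * ((p.1 : ℝ) + 1) * ((p.2 : ℝ) + 1) := by positivity
      show Real.pi * y₀ * ((p.1 : ℝ) + 1) * ((p.2 : ℝ) + 1) ≤ Real.pi * y * ((p.1 : ℝ) + 1) * ((p.2 : ℝ) + 1)
      nlinarith
    exact (continuousOn_besselIntegral hκ₀).comp hlin.continuousOn hmaps
  · -- domination by the term at `y₀`
    have hy' : y₀ ≤ y := hy
    have hκ₀ : 0 < Real.pi * y₀ * ((p.1 : ℝ) + 1) * ((p.2 : ℝ) + 1) := by positivity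
    have h0 : 0 ≤ Real.pi * ((p.1 : ℝ) + 1) * ((p.2 : ℝ) + 1) := by positivity
    have hle : Real.pi * y₀ * ((p.1 : ℝ) + 1) * ((p.2 : ℝ) + 1) ≤
        Real.pi * y * ((p.1 : ℝ) + 1) * ((p.2 : ℝ) + 1) := by nlinarith
    rw [Real.norm_of_nonneg (integral_inv_mul_exp_pos (hκ₀.trans_le hle)).le]
    exact besselIntegral_anti hκ₀ hle

/-- **The central value along `z = iy`**: for `Re z = 0`,
`Re Λ_z(½) = 2√y(γ + log y − log 4π) + 4√y Σ_{m,k≥1} I(πymk)`, `y = Im z`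
(`re_Λ_half_eq_exact` with `cos(2π·0·mk) = 1`). [cite: BatemanGrosswald1964, Theorem 1 (3)–(4) and p. 372] -/
theorem re_Λ_half_eq_of_re_zero (z : ℍ) (hre : z.re = 0) :
    ((thetaFEPair z).Λ ((1 / 2 : ℝ) : ℂ)).re =
      2 * Real.sqrt z.im * (Real.eulerMascheroniConstant + Real.log z.im - Real.log (4 * Real.pi)) +
      4 * Real.sqrt z.im * ∑' p : ℕ × ℕ, ∫ t in Ioi (0 : ℝ),
        t⁻¹ * Real.exp (-(Real.pi * z.im * ((p.1 : ℝ) + 1) * ((p.2 : ℝ) + 1)) * (t + t⁻¹)) := by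
  rw [re_Λ_half_eq_exact z, hre]
  simp only [mul_zero, zero_mul, Real.cos_zero, one_mul]

/-- **`y ↦ Λ_{iy}(½)` is continuous** on `[y₀, ∞)`, `y₀ > 0` (as the real function
`g(y) = 2√y(γ + log y − log 4π) + 4√y Σ I(πymk)`). [folklore] -/
theorem continuousOn_centralValueRect {y₀ : ℝ} (hy₀ : 0 < y₀) :
    ContinuousOn (fun y : ℝ =>
      2 * Real.sqrt y * (Real.eulerMascheroniConstant + Real.log y - Real.log (4 * Real.pi)) +
      4 * Real.sqrt y * ∑' p : ℕ × ℕ, ∫ t in Ioi (0 : ℝ),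
        t⁻¹ * Real.exp (-(Real.pi * y * ((p.1 : ℝ) + 1) * ((p.2 : ℝ) + 1)) * (t + t⁻¹))) (Ici y₀) := by
  have hS := continuousOn_tsum_besselIntegral hy₀
  have hlog : ContinuousOn Real.log (Ici y₀) :=
    Real.continuousOn_log.mono fun y hy => (hy₀.trans_le hy).ne'
  have hsqrt : ContinuousOn Real.sqrt (Ici y₀) := Real.continuous_sqrt.continuousOn
  refine ContinuousOn.add ?_ ?_
  · exact (continuousOn_const.mul hsqrt).mul ((continuousOn_const.add hlog).sub continuousOn_const)
  · exact (continuousOn_const.mul hsqrt).mul hS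

/-! ## A point of the family with `Λ_{iy}(½) = 0` -/

/-- `√3/2 ≤ 7.0554`. [folklore] -/
theorem sqrt_three_div_two_le : Real.sqrt 3 / 2 ≤ (7.0554 : ℝ) := by
  have h : Real.sqrt 3 ≤ 2 := Real.sqrt_le_iff.2 ⟨by norm_num, by norm_num⟩
  linarith

/-- **There is `y⋆ ∈ (7.0554, 7.0556)` with `Λ_{iy⋆}(½) = 0`** (intermediate value theorem between
Bateman–Grosswald's (11) at `k = 7.0554` and (10) at `k = 7.0556`).
[cite: BatemanGrosswald1964, Theorem 3 (10)–(11)] -/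
theorem exists_Λ_half_eq_zero :
    ∃ y : ℝ, (7.0554 : ℝ) < y ∧ y < 7.0556 ∧
      ∀ z : ℍ, z.re = 0 → z.im = y → (thetaFEPair z).Λ ((1 / 2 : ℝ) : ℂ) = 0 := by
  set g : ℝ → ℝ := fun y =>
    2 * Real.sqrt y * (Real.eulerMascheroniConstant + Real.log y - Real.log (4 * Real.pi)) +
      4 * Real.sqrt y * ∑' p : ℕ × ℕ, ∫ t in Ioi (0 : ℝ),
        t⁻¹ * Real.exp (-(Real.pi * y * ((p.1 : ℝ) + 1) * ((p.2 : ℝ) + 1)) * (t + t⁻¹)) with hg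
  have hcont : ContinuousOn g (Icc 7.0554 7.0556) :=
    (continuousOn_centralValueRect (by norm_num : (0 : ℝ) < 7.0554)).mono Icc_subset_Ici_self
  -- the two endpoints, as points `iy` of the upper half-plane
  set z₁ : ℍ := ⟨⟨0, 7.0554⟩, by show (0 : ℝ) < 7.0554; norm_num⟩ with hz₁
  set z₂ : ℍ := ⟨⟨0, 7.0556⟩, by show (0 : ℝ) < 7.0556; norm_num⟩ with hz₂
  have hz₁re : z₁.re = 0 := rfl
  have hz₁im : z₁.im = 7.0554 := rfl
  have hz₂re : z₂.re = 0 := rfl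
  have hz₂im : z₂.im = 7.0556 := rfl
  have h1 : g 7.0554 < 0 := by
    have h := re_Λ_half_neg z₁ (by rw [hz₁im]; exact sqrt_three_div_two_le) (by rw [hz₁im])
    rw [re_Λ_half_eq_of_re_zero z₁ hz₁re, hz₁im] at h
    exact h
  have h2 : 0 < g 7.0556 := by
    have h := re_Λ_half_pos_of_le z₂ (by rw [hz₂im])
    rw [re_Λ_half_eq_of_re_zero z₂ hz₂re, hz₂im] at h
    exact h
  obtain ⟨y, hy, hgy⟩ := intermediate_value_Icc (by norm_num : (7.0554 : ℝ) ≤ 7.0556) hcont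
    ⟨h1.le, h2.le⟩
  have hy1 : (7.0554 : ℝ) < y := lt_of_le_of_ne hy.1 fun h => by
    rw [← h] at hgy; linarith
  have hy2 : y < 7.0556 := lt_of_le_of_ne hy.2 fun h => by
    rw [h] at hgy; linarith
  refine ⟨y, hy1, hy2, fun z hre him => ?_⟩
  apply Complex.ext
  · rw [re_Λ_half_eq_of_re_zero z hre, him, Complex.zero_re]
    exact hgy
  · rw [im_Λ_ofReal, Complex.zero_im]

/-! ## The form `x² + c⋆y²` with a central zero -/

/-- **A positive definite binary form whose Epstein zeta function vanishes at `s = ½`** (barrier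
audit, generation 7): there is `c⋆ ∈ (7.0554², 7.0556²)`, i.e. Stark's `k = √c⋆` strictly inside
the Bateman–Grosswald window `(7.0554, 7.0556)`, such that EVERY analytic continuation `Z` of the
Epstein zeta function of `x² + c⋆y²` has `Z(½) = 0`. So central non-vanishing (Chowla's
`L(½, χ) ≠ 0` for `ζ_K = ζ·L(s, χ_d)`) cannot follow from properties shared by all `ζ_Q`.
[cite: BatemanGrosswald1964, Theorem 3 (10)–(11)] [cite: BeterminSamajTravenec2021, §4.2 (the edge zero Δ*_c on the real axis; numerics)] -/
theorem exists_form_central_zero :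
    ∃ c : ℝ, (7.0554 : ℝ) ^ 2 < c ∧ c < (7.0556 : ℝ) ^ 2 ∧ IsPosDefForm 1 0 c ∧
      (7.0554 : ℝ) < starkK 1 0 c ∧ starkK 1 0 c < 7.0556 ∧
      ∀ Z : ℂ → ℂ, IsEpsteinContinuation 1 0 c Z → Z (1 / 2) = 0 := by
  obtain ⟨y, hy1, hy2, hΛ⟩ := exists_Λ_half_eq_zero
  have hy0 : 0 < y := by linarith
  have h : IsPosDefForm 1 0 (y ^ 2) := ⟨one_pos, by nlinarith⟩
  have hk : starkK 1 0 (y ^ 2) = y := by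
    rw [starkK_one, show (4 : ℝ) * y ^ 2 - 0 ^ 2 = (2 * y) ^ 2 by ring,
      Real.sqrt_sq (by linarith)]
    ring
  refine ⟨y ^ 2, by nlinarith, by nlinarith, h, by rw [hk]; exact hy1, by rw [hk]; exact hy2,
    fun Z hZ => ?_⟩
  obtain ⟨z, hre, him, hk'⟩ := exists_zQ' h
  have hZ' : IsEpsteinContinuation (y ^ 2) 0 1 Z := (isEpsteinContinuation_swap_iff 1 0 (y ^ 2) Z).2 hZ
  have e := continuation_ofReal_eq h.swap z hre him hZ' (σ := 1 / 2) (by norm_num) (by norm_num)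
  have hΛ' := hΛ z (by rw [hre]; simp) (by rw [hk', hk])
  have hhalf : ((1 / 2 : ℝ) : ℂ) = 1 / 2 := by push_cast; rfl
  rw [hhalf] at e hΛ'
  rw [e, hΛ', mul_zero]

/-- The same form read as `(c⋆, 0, 1)` (`c⋆x² + y²`, Stark's `k = 1/√c⋆ ∈ (1/7.0556, 1/7.0554)`,
the orientation `Δ < Δ*_c` of Bétermin–Šamaj–Travěnec): its continuations vanish at `½` too.
[cite: BeterminSamajTravenec2021, §4.2] -/
theorem exists_form_central_zero_swap :
    ∃ c : ℝ, (7.0554 : ℝ) ^ 2 < c ∧ c < (7.0556 : ℝ) ^ 2 ∧ IsPosDefForm c 0 1 ∧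
      ∀ Z : ℂ → ℂ, IsEpsteinContinuation c 0 1 Z → Z (1 / 2) = 0 := by
  obtain ⟨c, h1, h2, h, -, -, hZ⟩ := exists_form_central_zero
  exact ⟨c, h1, h2, h.swap, fun Z hZc => hZ Z ((isEpsteinContinuation_swap_iff 1 0 c Z).1 hZc)⟩

/-! ## Central zeros are double zeros -/

/-- Points of the ball `|s − ½| < ½` are not integers. [folklore] -/
theorem ne_intCast_of_mem_ball {s : ℂ} (hs : s ∈ Metric.ball (1 / 2 : ℂ) (1 / 2)) (n : ℤ) :
    s ≠ (n : ℂ) := by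
  intro h
  rw [Metric.mem_ball, h, dist_eq_norm] at hs
  have hre : |((n : ℂ) - 1 / 2).re| ≤ ‖(n : ℂ) - 1 / 2‖ := Complex.abs_re_le_norm _
  have hre' : ((n : ℂ) - 1 / 2).re = (n : ℝ) - 1 / 2 := by
    rw [Complex.sub_re, Complex.intCast_re, Complex.div_ofNat_re, Complex.one_re]
  rw [hre'] at hre
  have h2 : (1 : ℝ) / 2 ≤ |(n : ℝ) - 1 / 2| := by
    rcases le_or_gt n 0 with hn | hn
    · have : (n : ℝ) ≤ 0 := by exact_mod_cast hn
      rw [abs_of_neg (by linarith)]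
      linarith
    · have : (1 : ℝ) ≤ n := by exact_mod_cast hn
      rw [abs_of_nonneg (by linarith)]
      linarith
  linarith

/-- **A central zero of an Epstein zeta function is at least a double zero**: if some (equivalently
every) analytic continuation `Z` of `ζ_Q` has `Z(½) = 0`, then `Z′(½) = 0` — the completed function
`ξ_Q(s) = Z(s)Γ(s)(−d)^{s/2}(2π)^{−s}` satisfies `ξ_Q(s) = ξ_Q(1 − s)` near `½`
(`MontgomeryVaughan2007_epsteinContinuation_holds`), so `ξ_Q′(½) = 0`, and the completing factor
does not vanish at `½`. [cite: MontgomeryVaughan2007, §10.1 Exercise 25 (e)] -/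
theorem deriv_half_eq_zero_of_half_eq_zero {a b c : ℝ} (h : IsPosDefForm a b c) {Z : ℂ → ℂ}
    (hZ : IsEpsteinContinuation a b c Z) (h0 : Z (1 / 2) = 0) : deriv Z (1 / 2) = 0 := by
  obtain ⟨Z₀, hZ₀, hFE⟩ := MontgomeryVaughan2007_epsteinContinuation_holds a b c h
  -- `Z = Z₀` near `½`
  have hopen : IsOpen {s : ℂ | s ≠ 1} := isOpen_ne
  have hmem : (1 / 2 : ℂ) ∈ {s : ℂ | s ≠ 1} := by norm_num
  have hnhds : {s : ℂ | s ≠ 1} ∈ 𝓝 (1 / 2 : ℂ) := hopen.mem_nhds hmem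
  have hev : Z =ᶠ[𝓝 (1 / 2 : ℂ)] Z₀ := Filter.eventuallyEq_of_mem hnhds (hZ.eqOn hZ₀)
  have h0' : Z₀ (1 / 2) = 0 := by rw [← hZ.eqOn hZ₀ hmem]; exact h0
  rw [hev.deriv_eq]
  -- the completed function is even about `½` near `½`
  have hball : Metric.ball (1 / 2 : ℂ) (1 / 2) ∈ 𝓝 (1 / 2 : ℂ) := Metric.ball_mem_nhds _ (by norm_num)
  have hξev : epsteinXi a b c Z₀ =ᶠ[𝓝 (1 / 2 : ℂ)] fun s => epsteinXi a b c Z₀ (1 - s) := by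
    filter_upwards [hball] with s hs
    exact hFE s (ne_intCast_of_mem_ball hs)
  have hdξ : deriv (epsteinXi a b c Z₀) (1 / 2) = 0 := by
    have e1 := hξev.deriv_eq
    rw [deriv_comp_const_sub, show (1 : ℂ) - 1 / 2 = 1 / 2 by norm_num] at e1
    linear_combination (1 / 2 : ℂ) * e1
  -- differentiate the product `ξ = Z₀ · Γ · D^{s/2} · (2π)^{−s}` at `½`
  have hD : (0 : ℝ) < 4 * a * c - b ^ 2 := h.four_ac_sub_sq_pos
  have hDc : ((4 * a * c - b ^ 2 : ℝ) : ℂ) ≠ 0 := by exact_mod_cast hD.ne'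
  have h2π : ((2 * Real.pi : ℝ) : ℂ) ≠ 0 := by
    have : (2 * Real.pi : ℝ) ≠ 0 := by positivity
    exact_mod_cast this
  have hne : ∀ n : ℤ, (1 / 2 : ℂ) ≠ n := ne_intCast_of_mem_ball (Metric.mem_ball_self (by norm_num))
  have hΓm : ∀ m : ℕ, (1 / 2 : ℂ) ≠ -m := fun m => by exact_mod_cast hne (-m)
  have hZd : DifferentiableAt ℂ Z₀ (1 / 2) := hZ₀.1.differentiableAt hnhds
  have hΓd : DifferentiableAt ℂ Complex.Gamma (1 / 2) := Complex.differentiableAt_Gamma _ hΓm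
  have hΓ0 : Complex.Gamma (1 / 2) ≠ 0 := Complex.Gamma_ne_zero hΓm
  have hprod := ((hZd.hasDerivAt.mul hΓd.hasDerivAt).mul
    (((hasDerivAt_id' (1 / 2 : ℂ)).div_const 2).const_cpow (Or.inl hDc))).mul
    ((hasDerivAt_neg' (1 / 2 : ℂ)).const_cpow (Or.inl h2π))
  -- the product just differentiated IS `ξ = epsteinXi a b c Z₀` (definitionally)
  have hF : HasDerivAt (epsteinXi a b c Z₀) (deriv (epsteinXi a b c Z₀) (1 / 2)) (1 / 2) :=
    hprod.differentiableAt.hasDerivAt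
  have hf := hprod.unique hF
  rw [hdξ] at hf
  simp only [Pi.mul_apply, h0', zero_mul, add_zero] at hf
  -- `hf : Z₀′(½) Γ(½) D^{¼} (2π)^{−½} = 0`
  rcases mul_eq_zero.1 hf with h5 | h5
  · rcases mul_eq_zero.1 h5 with h6 | h6
    · rcases mul_eq_zero.1 h6 with h7 | h7
      · exact h7
      · exact absurd h7 hΓ0
    · exact absurd h6 (Complex.cpow_ne_zero_iff.2 (Or.inl hDc))
  · exact absurd h5 (Complex.cpow_ne_zero_iff.2 (Or.inl h2π))

/-- **The double central zero in the family** (barrier audit, generation 7): the form `x² + c⋆y²`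
of `exists_form_central_zero` has `Z(½) = Z′(½) = 0` for every analytic continuation `Z` of its
Epstein zeta function — two critical zeros have collided at the central point. Hence neither the
simplicity of the zeros on `σ = ½` (Stark's Theorem 1 asserts it only for `k > K`) nor central
non-vanishing is a consequence of the structure shared by all `ζ_Q`.
[cite: BatemanGrosswald1964, Theorem 3 (10)–(11)] [cite: Stark1967EpsteinZeros, Theorem 1] [cite: BeterminSamajTravenec2021, §4.2] -/
theorem exists_form_central_double_zero :
    ∃ c : ℝ, (7.0554 : ℝ) ^ 2 < c ∧ c < (7.0556 : ℝ) ^ 2 ∧ IsPosDefForm 1 0 c ∧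
      ∀ Z : ℂ → ℂ, IsEpsteinContinuation 1 0 c Z → Z (1 / 2) = 0 ∧ deriv Z (1 / 2) = 0 := by
  obtain ⟨c, h1, h2, h, -, -, hZ⟩ := exists_form_central_zero
  exact ⟨c, h1, h2, h, fun Z hZc => ⟨hZ Z hZc, deriv_half_eq_zero_of_half_eq_zero h hZc (hZ Z hZc)⟩⟩

end Literature.Barriers.RiemannHypothesis
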